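import Summits.FinalStateConjecture.FinalStateConjecture.Theses.PhotonSphereChannels
import Summits.FinalStateConjecture.FinalStateConjecture.Theorems.PhotonSphereChannelsTameHullDefs
import Summits.FinalStateConjecture.FinalStateConjecture.Theorems.PhotonSphereChannelsDarkFutureDefs
import Summits.FinalStateConjecture.FinalStateConjecture.Theorems.PhotonSphereChannelsKerrDevDefs
import Summits.FinalStateConjecture.FinalStateConjecture.Cruxes.ChannelsResolveTameDevelopmentsR.K2REquivPhi
import HarnessLib

/-!
# Strategy census s8 (independent, family `s`) — typed companion of `STRATEGY-CENSUS-s8.md`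

Crux `ChannelsResolveTameDevelopmentsR` (K2R, item stmt-FinalStateConjecture-17430) of route
`PhotonSphereChannels`; K2R ↔ Φ (`Disproof.TameResolution`) since K1R is proved.

What is typed here (every theorem sorry-free):

* §1 `TameOuterAtOrder 𝒟 k` — hypothesis (ii) of Φ with `3 ↦ k` (per-order radius and constant), and
  `TameOuterAllOrders 𝒟 := ∀ k, TameOuterAtOrder 𝒟 k`; `tameOuterAtOrder_three` : (ii) IS order 3.
* §2 THE WEAKER INTERMEDIATE `SmoothTameResolution` (Φ∞): Φ with the extra hypothesis (ii)∞. It is what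
  every rigidity / compactness engine in print consumes (hull elements are `Spacetime`s = `C^∞` Lorentzian
  manifolds, `Literature.Geometry.Lorentzian.Spacetime`; a pointed `C²_loc` limit of `C³`-bounded metrics is
  only `C^{2,α}`), and `Φ → Φ∞` trivially (`smoothTameResolution_of_tameResolution`).
* §3 THE DECOMPOSITION: P1 `AprioriTameUpgrade` (DevHyp ⇒ (ii)∞ : the regularity debt "F0" as a
  stand-alone Prop — mechanism-free in vacuum, recommended to become a HYPOTHESIS by a route restate of
  (ii)) and P2 `SmoothSilentHull` (DevHyp + (ii)∞ ⇒ silent outer/generator hulls in one all-orders class —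
  compactness + Bondi/area budgets). Assemblies: `k2R_of_upgrade_of_smoothTameResolution : P1 → Φ∞ → K2R`
  and `silentHullCore_of_upgrade_of_smoothHull : P1 → P2 → A″`, where `SilentHullCore'` is byte-identical
  to `Registered.SilentHullCore` (stub A″) of `Lines/tame_lasalle_dock.lean` §2, whose kernel-checked §4
  composition takes A″ and the docked stubs SEK/D/N/K♭/T′/C to the crux. So (P1, P2) is a glued split of
  node A″ of the registered line, and (P1, Φ∞) a glued split of the crux itself.
* §5 THE STRENGTHENING S⁺ `EternalSilentEndRigidity` (development-free rigidity of silent tame ends,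
  `|a| ≤ M`) and its one-line use on silent hull elements.
-/

noncomputable section

set_option maxSynthPendingDepth 3
set_option linter.dupNamespace false

open Set Filter Function TopologicalSpace Manifold Bundle
open scoped Topology Manifold ContDiff ENNReal NNReal

namespace Summit.FinalStateConjecture.FinalStateConjecture.Cruxes.ChannelsResolveTameDevelopmentsR.CensusS8

open Literature.Geometry.Lorentzian
open Summit.FinalStateConjecture.FinalStateConjecture.Theorems.TameHull
open Summit.FinalStateConjecture.FinalStateConjecture.Theses.PhotonSphereChannels

/-! ### §1 Tameness of the outer region at order `k` and at all orders -/

section Development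

variable {X : Type} [TopologicalSpace X] [ChartedSpace E3 X] [IsManifold (𝓡 3) ∞ X]
  [T2Space X] [SecondCountableTopology X] [ConnectedSpace X] {D : InitialDataSet (𝓡 3) X}

/-- Hypothesis (ii) of Φ with `3 ↦ k`: the outer region is covered by centred smooth coordinate balls of ONE
radius `r > 0` with `sup_{C^k} ‖Ψ^*g − η‖ ≤ Λ` and `sup_{C⁰} ‖Ψ^*g − η‖ ≤ 1/2` (radius and constant may
depend on `k`). `TameOuterAtOrder 𝒟 3` is `TameHull.TameOuter 𝒟` verbatim. [cite: Anderson2004, Def. 1.1] -/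
def TameOuterAtOrder (𝒟 : VacuumCauchyDevelopment D) (k : ℕ) : Prop :=
  ∀ [𝒟.metric.HasLeviCivita], ∃ r₀ : ℝ, 0 < r₀ ∧ ∃ Λ : ℝ≥0, ∀ q ∈ outerRegion 𝒟,
    let U : Opens E4 := ⟨Metric.ball (0 : E4) r₀, Metric.isOpen_ball⟩
    ∃ Ψ : U → 𝒟.carrier, 𝒟.toSpacetime.IsLateChart (Minkowski.backgroundOn U) Set.univ (-r₀) Ψ ∧
      (∃ x : U, (x : E4) = 0 ∧ Ψ x = q) ∧
      supCkENorm (U : Set E4) k (𝒟.toSpacetime.deviationExtend (Minkowski.backgroundOn U) Ψ) ≤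
          (Λ : ℝ≥0∞) ∧
        supCkENorm (U : Set E4) 0 (𝒟.toSpacetime.deviationExtend (Minkowski.backgroundOn U) Ψ) ≤
          1 / 2

/-- (ii)∞ — the outer region is tame AT EVERY ORDER (per-order radius and constant; the weakest form from
which pointed Cheeger–Gromov limits are smooth). [cite: Anderson2004, Thm 5.1] -/
def TameOuterAllOrders (𝒟 : VacuumCauchyDevelopment D) : Prop :=
  ∀ k : ℕ, TameOuterAtOrder 𝒟 k

omit [T2Space X] [SecondCountableTopology X] in
/-- (ii) is tameness at order `3` (definitional). [folklore] -/
theorem tameOuterAtOrder_three {𝒟 : VacuumCauchyDevelopment D} (h : DevHyp 𝒟) :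
    TameOuterAtOrder 𝒟 3 :=
  fun {_} ↦ h.tame

omit [T2Space X] [SecondCountableTopology X] in
/-- (ii)∞ gives back (ii) (its order-`3` instance). [folklore] -/
theorem tameOuter_of_allOrders {𝒟 : VacuumCauchyDevelopment D} (h : TameOuterAllOrders 𝒟) :
    TameOuter 𝒟 :=
  fun {_} ↦ h 3

/-- The T2 conclusion of Φ on one development, verbatim. [cite: DafermosLuk2017, Conjecture 1] -/
def Concl (𝒟 : VacuumCauchyDevelopment D) : Prop :=
  ∃ (O : Set 𝒟.carrier) (d : FinalStateDecomposition 𝒟.toSpacetime O 2),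
    O = _root_.Summit.FinalStateConjecture.exteriorOf 𝒟.toCauchyDevelopment d.charted ∧
      _root_.Summit.FinalStateConjecture.RaysStayInClosure 𝒟.toCauchyDevelopment O ∧
        _root_.Summit.FinalStateConjecture.HasExhaustiveCharts d ∧
          _root_.Summit.FinalStateConjecture.IsFutureOriented d

end Development

/-! ### §2 The weaker intermediate Φ∞ and §3 the pieces P1, P2 -/

/-- **Φ∞ = `SmoothTameResolution`** — Φ for developments whose outer region is tame at every order: for
every admissible datum and every MGHD with complete `𝓘⁺`, (i), (ii) AND (ii)∞, the T2 conclusion holds.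
Weaker than Φ (one more hypothesis, `smoothTameResolution_of_tameResolution`); it is the statement the
registered ω-limit line actually proves toward (its hull elements are smooth `Spacetime`s in an all-orders
class). Why it might fail: exactly as Φ minus the regularity debt — smooth non-Kerr stationary ends
(uniqueness without analyticity open), AF breathers excluded only near `𝓘`, hidden-bag ray clause. [cite: DafermosLuk2017, Conjecture 1] [cite: AlexakisSchlue2018, Thm 1.2] -/
def SmoothTameResolution : Prop :=
  ∀ (X : Type) [TopologicalSpace X] [ChartedSpace E3 X] [IsManifold (𝓡 3) ∞ X] [T2Space X]
    [SecondCountableTopology X] [ConnectedSpace X], ∀ D ∈ admissibleVacuumData X,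
    ∀ (𝒟 : VacuumCauchyDevelopment D) [𝒟.metric.HasLeviCivita], DevHyp 𝒟 → TameOuterAllOrders 𝒟 →
      Concl 𝒟

/-- **P1 = `AprioriTameUpgrade`** — the regularity debt as a stand-alone statement: an MGHD of admissible
data with complete `𝓘⁺`, (i) and a `C³`-tame outer region has an outer region tame at EVERY order
(constants depending on the order). No mechanism in vacuum (no smoothing; Grönwall on commuted equations
gives `e^{Ct}`, not uniform, bounds); not implied by Φ either (Φ's conclusion is `C²` convergence). Why it
might fail: a development radiating an ever rougher, ever weaker wave train (bounded `C³`, unbounded `C⁴`)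
is not excluded by any theorem. POSTSCRIPT (after reading census s4 §1): FALSE on paper on the DevHyp class —
admissibility (`IsStronglyAsymptoticallyFlatWith e D M 1 2 2 1`) controls two derivatives of `h` only, so a
CK-small far ripple `ε·sin(e^r)·e^{−λr}` gives a geodesically complete, `C³`-tame MGHD whose outer region is
not `C¹²`-tame at far points of `ιΣ` nor, by focusing, at the centre at late times; kept here as the TYPED
statement of the debt. DISPOSAL (forced, not optional): move to the hypothesis side (restate (ii) as (ii)∞ in
K2R and in K3's bundle `Q`; `closes` keeps its shape). [cite: Anderson2004, Thm 5.1] -/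
def AprioriTameUpgrade : Prop :=
  ∀ (X : Type) [TopologicalSpace X] [ChartedSpace E3 X] [IsManifold (𝓡 3) ∞ X] [T2Space X]
    [SecondCountableTopology X] [ConnectedSpace X], ∀ D ∈ admissibleVacuumData X,
    ∀ (𝒟 : VacuumCauchyDevelopment D) [𝒟.metric.HasLeviCivita], DevHyp 𝒟 → TameOuterAllOrders 𝒟

/-- **P2 = `SmoothSilentHull`** — stub A″ of `tame-lasalle-dock` RELIEVED of the regularity debt: under
DevHyp AND (ii)∞ the outer region is nonempty and there is one all-orders class `(Λ, r₀)` with silent outer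
hull elements along every future-escaping outer sequence and horizon-hull elements along every generator
path. Content: pointed Cheeger–Gromov compactness (smooth limits from all-orders bounds), production of
the eternal far chart of the limit (uniform-in-time weighted AF-ness of ω-limits — the piece with no
large-data mechanism in print; in the sibling theory it is the "compactness property"), clock, and SILENCE
from the Bondi-mass and horizon-area budgets. Why it might fail: far constants of the limits unbounded
(curvature concentrations / companions receding sublinearly); Bondi flux undefined at this regularity at
`𝓘⁺`. [cite: Anderson2004, Thm 5.1] [cite: ChristodoulouKlainerman1993, Ch. 17] -/
def SmoothSilentHull : Prop :=
  ∀ (X : Type) [TopologicalSpace X] [ChartedSpace E3 X] [IsManifold (𝓡 3) ∞ X] [T2Space X]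
    [SecondCountableTopology X] [ConnectedSpace X], ∀ D ∈ admissibleVacuumData X,
    ∀ (𝒟 : VacuumCauchyDevelopment D) [𝒟.metric.HasLeviCivita], DevHyp 𝒟 → TameOuterAllOrders 𝒟 →
      (outerRegion 𝒟).Nonempty ∧
        ∃ (Λ : ℕ → ℝ≥0) (r₀ : ℝ), 0 < r₀ ∧ OuterHullExists 𝒟 Λ r₀ ∧ GeneratorHullExists 𝒟 Λ r₀

/-- `SilentHullCore'` — byte-identical copy of `Registered.SilentHullCore` (stub A″) of
`Cruxes/ChannelsResolveTameDevelopmentsR/Lines/tame_lasalle_dock.lean` §2 (copied, not imported, so that this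
file does not depend on a sorried skeleton). [cite: Anderson2004, Thm 5.1] -/
def SilentHullCore' : Prop :=
  ∀ (X : Type) [TopologicalSpace X] [ChartedSpace E3 X] [IsManifold (𝓡 3) ∞ X] [T2Space X]
    [SecondCountableTopology X] [ConnectedSpace X], ∀ D ∈ admissibleVacuumData X,
    ∀ (𝒟 : VacuumCauchyDevelopment D) [𝒟.metric.HasLeviCivita], DevHyp 𝒟 →
      (outerRegion 𝒟).Nonempty ∧
        ∃ (Λ : ℕ → ℝ≥0) (r₀ : ℝ), 0 < r₀ ∧ OuterHullExists 𝒟 Λ r₀ ∧ GeneratorHullExists 𝒟 Λ r₀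

/-! ### §4 Assemblies (sorry-free) -/

/-- Φ ⇒ Φ∞ (the intermediate is weaker: drop the extra hypothesis). [folklore] -/
theorem smoothTameResolution_of_tameResolution (hΦ : Disproof.TameResolution) : SmoothTameResolution := by
  intro X _ _ _ _ _ _ D hD 𝒟 _ hdev _
  exact hΦ X D hD 𝒟 hdev.maximal hdev.scri ⟨hdev.noRemnant, hdev.tame⟩

/-- **Glued split of the crux: P1 → Φ∞ → K2R.** [folklore] -/
theorem k2R_of_upgrade_of_smoothTameResolution (hP1 : AprioriTameUpgrade)
    (hΦ : SmoothTameResolution) : ChannelsResolveTameDevelopmentsR := by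
  intro _hK1R X _ _ _ _ _ _ D hD 𝒟 hmax hscri hhyp
  haveI : 𝒟.metric.HasLeviCivita := 𝒟.metric.toPseudoRiemannianMetric.hasLeviCivita
  have hdev : DevHyp 𝒟 := ⟨hmax, hscri, hhyp.1, hhyp.2⟩
  exact hΦ X D hD 𝒟 hdev (hP1 X D hD 𝒟 hdev)

/-- The same split, landing in Φ (`Disproof.TameResolution`). [folklore] -/
theorem tameResolution_of_upgrade_of_smoothTameResolution (hP1 : AprioriTameUpgrade)
    (hΦ : SmoothTameResolution) : Disproof.TameResolution :=
  Disproof.tameResolution_of_k2R (k2R_of_upgrade_of_smoothTameResolution hP1 hΦ)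

/-- **Glued split of node A″ of the registered line: P1 → P2 → A″.** [folklore] -/
theorem silentHullCore_of_upgrade_of_smoothHull (hP1 : AprioriTameUpgrade) (hP2 : SmoothSilentHull) :
    SilentHullCore' := by
  intro X _ _ _ _ _ _ D hD 𝒟 _ hdev
  exact hP2 X D hD 𝒟 hdev (hP1 X D hD 𝒟 hdev)

/-- Conversely A″ as registered gives P2 outright (P2 is A″ with one more hypothesis). [folklore] -/
theorem smoothSilentHull_of_silentHullCore (hA : SilentHullCore') : SmoothSilentHull := by
  intro X _ _ _ _ _ _ D hD 𝒟 _ hdev _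
  exact hA X D hD 𝒟 hdev

/-! ### §5 The strengthening S⁺ (pure Lorentzian rigidity, developments removed) -/

/-- **S⁺ = `EternalSilentEndRigidity`** — every smooth eternal vacuum end in an all-orders tame class
which is SILENT (two-sided non-radiating at order `1/r`, non-expanding shear-free horizon, red-shifted or
cold) is Minkowski space or has domain of outer communications EXACTLY a Kerr exterior with `|a| ≤ M`
(`≤`, not `<`: the outgoing extremal Kerr–Schild patch is a tame non-radiating end with empty future
horizon and extremal d.o.c., `Theorems/ChannelsResolveTameDevelopments/Negative/EmptyHorizonEnd`). Stronger than what Φ∞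
needs (ends need not arise as hulls) and development-free, so Carleman / unique-continuation and the
near-Kerr Liouville route apply directly; its non-perturbative core is the repaired item U′ (smooth
black-hole uniqueness without analyticity: known only for small Mars–Simon tensor). Why it might fail: a
smooth non-Kerr stationary vacuum black hole, or an AF vacuum geon silent at order `1/r` but radiating at
higher order. [cite: AlexakisSchlue2018, Thm 1.2] [cite: ChruscielEtAl2001, Thm 1.1] -/
def EternalSilentEndRigidity : Prop :=
  ∀ (𝓢 : Spacetime.{0} 4) (E : EndDatum 𝓢) (Λ : ℕ → ℝ≥0) (r₀ : ℝ), IsTameClass E Λ r₀ → E.IsSilent →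
    IsMinkowski 𝓢 ∨ ∃ M a : ℝ, 0 < M ∧ |a| ≤ M ∧ IsKerrDoc 𝓢 E.doc M a

section Hull

variable {X : Type} [TopologicalSpace X] [ChartedSpace E3 X] [IsManifold (𝓡 3) ∞ X]
  [T2Space X] [SecondCountableTopology X] [ConnectedSpace X] {D : InitialDataSet (𝓡 3) X}

omit [T2Space X] [SecondCountableTopology X] in
/-- S⁺ classifies every silent outer hull element (the `out` half of the hypothesis of the registered
endgame T′, before the extremal case is removed by N). [folklore] -/
theorem hullElement_rigid_of_eternalSilentEndRigidity (hS : EternalSilentEndRigidity)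
    {𝒟 : VacuumCauchyDevelopment D} [𝒟.metric.HasLeviCivita] {Λ : ℕ → ℝ≥0} {r₀ : ℝ}
    {q : ℕ → 𝒟.carrier} {𝓢 : Spacetime.{0} 4} {E : EndDatum 𝓢} {p : 𝓢.carrier}
    (h : IsSilentHullElement 𝒟 Λ r₀ q 𝓢 E p) :
    IsMinkowski 𝓢 ∨ ∃ M a : ℝ, 0 < M ∧ |a| ≤ M ∧ IsKerrDoc 𝓢 E.doc M a :=
  hS 𝓢 E Λ r₀ h.2.1 h.2.2.1

end Hull

end Summit.FinalStateConjecture.FinalStateConjecture.Cruxes.ChannelsResolveTameDevelopmentsR.CensusS8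

end
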